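import Summits.SmoothPoincare4.SmoothPoincare4.Theorems.ConvexBisectionAcyclicBisectionRigiditySeamGluingModel
import Literature.Topology.FourManifolds.GluingProofs
import HarnessLib

/-!
# Seam gluing of Morse functions, V: every gluing `M ∪_φ N`, and bisected closed 4-manifolds

Helper file (lead c1, crux `ConvexBisection.AcyclicBisectionRigidity`, item
stmt-SmoothPoincare4-10507).  The MORSE GLUING ACROSS THE SEAM asked for by both round-2 cross-seam
levers (`stub_seamPairDichotomy` of line seam-duality-cancellation, size "(L): glued Morse function
on `M` from adapted Morse functions on the halves"; `stub_crossCancellation` of line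
exchange-recognition, lever audit §3 (i)) and usable by crux 4's lines:

* `exists_isMorse_of_isBoundaryGluing` — for compact `(n+2)`-manifolds with nonempty boundary `M`,
  `N`, adapted Morse functions `f_M`, `f_N`, a diffeomorphism `φ : ∂M ≅ ∂N` and ANY smooth manifold
  `P` which is the gluing `M ∪_φ N` (`IsBoundaryGluing`), there is a Morse function on `P` with
  `#Crit_i = #Crit_i(f_M) + #Crit_j(f_N)` (`i + j = n + 2`): the model gluing carries one
  (`exists_isMorse_glued`), the gluing is unique up to diffeomorphism
  (`nonempty_diffeomorph_of_isBoundaryGluing_holds`, Hirsch Thm. 8.2.1), and Morse data transport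
  along diffeomorphisms (`IsMorse.comp_diffeomorph`, `ncard_criticalSetOfIndex_comp_diffeomorph`);
* `isBoundaryGluing_of_bisection` — two smoothly embedded compact pieces covering a manifold and
  meeting exactly along the images of their boundaries, with a seam diffeomorphism `ψ : ∂W₁ ≅ ∂W₂`
  (`e₂ ∘ incl ∘ ψ = e₁ ∘ incl`), present it as the gluing `W₁ ∪_ψ W₂`;
* `exists_isMorse_of_bisection` — hence a closed smooth 4-manifold bisected in this way, with
  adapted Morse functions of profiles `c(f₁)`, `c(f₂)` on the halves, carries a Morse function with
  `#Crit_i = c_i(f₁) + c_{4-i}(f₂)` — e.g. profile `(c₀(f₁); c₁(f₁); c₂(f₁)+c₂(f₂); c₁(f₂); c₀(f₂))`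
  for two 2-handlebodies, the starting point of every cross-seam cancellation argument.

Everything is proved; no definitions. [folklore]
-/

noncomputable section

open scoped Manifold ContDiff Topology
open Set Function Filter Literature.Topology.FourManifolds

-- the prescribed namespace `Summit.<P>.<Sub>.…` duplicates `SmoothPoincare4` (P = Sub)
set_option linter.dupNamespace false

namespace Summit.SmoothPoincare4.SmoothPoincare4.Theorems.AcyclicBisectionRigidity.SeamGluing

universe u

/-! ### Every gluing carries the glued Morse function -/

section AnyGluing

variable {n : ℕ} {M N : Type u}
  [TopologicalSpace M] [T2Space M] [CompactSpace M] [ChartedSpace (EuclideanHalfSpace (n + 2)) M]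
  [IsManifold (𝓡∂ (n + 2)) ∞ M]
  [TopologicalSpace N] [T2Space N] [CompactSpace N] [ChartedSpace (EuclideanHalfSpace (n + 2)) N]
  [IsManifold (𝓡∂ (n + 2)) ∞ N]
  {bM : BoundaryData (𝓡∂ (n + 2)) M (𝓡 (n + 1))} {bN : BoundaryData (𝓡∂ (n + 2)) N (𝓡 (n + 1))}
  [Nonempty bM.carrier] [Nonempty bN.carrier]

/-- **Morse gluing across the seam.**  Let `M`, `N` be compact smooth `(n+2)`-manifolds with
nonempty boundary, `f_M`, `f_N` Morse functions adapted to the boundary, `φ : ∂M ≅ ∂N` a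
diffeomorphism and `P` any smooth manifold which is the gluing `M ∪_φ N`.  Then `P` carries a Morse
function whose critical points of index `i` number `#Crit_i(f_M) + #Crit_j(f_N)` for `i + j = n + 2`
(Milnor 1965, §1 and proof of Thm. 3.4; uniqueness of gluings, Hirsch 1976, Thm. 8.2.1).
[cite: MilnorHCobordism1965, §1 and proof of Thm. 3.4] [cite: HirschDT1976, Ch. 8 §2, Thm. 2.1] -/
theorem exists_isMorse_of_isBoundaryGluing {fM : M → ℝ} (hfM : IsMorseAdapted (𝓡∂ (n + 2)) fM)
    {fN : N → ℝ} (hfN : IsMorseAdapted (𝓡∂ (n + 2)) fN)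
    (φ : bM.carrier ≃ₘ⟮𝓡 (n + 1), 𝓡 (n + 1)⟯ bN.carrier)
    {P : Type u} [TopologicalSpace P] [ChartedSpace (EuclideanSpace ℝ (Fin (n + 2))) P]
    [IsManifold (𝓡 (n + 2)) ∞ P] (hP : IsBoundaryGluing bM bN φ (𝓡 (n + 2)) P) :
    ∃ F : P → ℝ, IsMorse (𝓡 (n + 2)) F ∧
      ∀ i j : ℕ, i + j = n + 2 →
        (criticalSetOfIndex (𝓡 (n + 2)) F i).ncard =
          (criticalSetOfIndex (𝓡∂ (n + 2)) fM i).ncard + (criticalSetOfIndex (𝓡∂ (n + 2)) fN j).ncard := by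
  obtain ⟨G, F₀, hGφ, hF₀, hcount⟩ := exists_isMorse_glued hfM hfN φ
  have hP₀ : IsBoundaryGluing bM bN G.φ (𝓡 (n + 1 + 1)) G.d₂.Glued := G.isBoundaryGluing
  rw [hGφ] at hP₀
  obtain ⟨Ψ⟩ := nonempty_diffeomorph_of_isBoundaryGluing_holds hP hP₀
  refine ⟨F₀ ∘ Ψ, IsMorse.comp_diffeomorph Ψ hF₀, fun i j hij => ?_⟩
  rw [ncard_criticalSetOfIndex_comp_diffeomorph Ψ hF₀.contMDiff i]
  exact hcount i j hij

end AnyGluing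

/-! ### Bisected manifolds -/

section Bisection

variable {m : ℕ} {X : Type u} [TopologicalSpace X] [ChartedSpace (EuclideanSpace ℝ (Fin (m + 1))) X]
  {W₁ : Type u} [TopologicalSpace W₁] [ChartedSpace (EuclideanHalfSpace (m + 1)) W₁]
  {W₂ : Type u} [TopologicalSpace W₂] [ChartedSpace (EuclideanHalfSpace (m + 1)) W₂]

/-- **A bisection is a boundary gluing.**  If `e₁ : W₁ → X`, `e₂ : W₂ → X` are smooth embeddings
whose ranges cover `X` and meet exactly in `e₁(∂W₁)`, and `ψ : ∂W₁ ≅ ∂W₂` is a seam map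
(`e₂ (incl (ψ z)) = e₁ (incl z)`), then `X` is the gluing `W₁ ∪_ψ W₂` in the sense of
`IsBoundaryGluing` (pieces `e₁`, `e₂`; the gluing relation is the seam by injectivity of `e₂`).
[folklore] -/
theorem isBoundaryGluing_of_bisection {e₁ : W₁ → X} {e₂ : W₂ → X}
    (he₁ : Manifold.IsSmoothEmbedding (𝓡∂ (m + 1)) (𝓡 (m + 1)) ∞ e₁)
    (he₂ : Manifold.IsSmoothEmbedding (𝓡∂ (m + 1)) (𝓡 (m + 1)) ∞ e₂)
    (hcover : range e₁ ∪ range e₂ = univ)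
    (hseam₁ : range e₁ ∩ range e₂ = e₁ '' (𝓡∂ (m + 1)).boundary W₁)
    (b₁ : BoundaryData (𝓡∂ (m + 1)) W₁ (𝓡 m)) (b₂ : BoundaryData (𝓡∂ (m + 1)) W₂ (𝓡 m))
    (ψ : b₁.carrier → b₂.carrier) (hψ : ∀ z, e₂ (b₂.incl (ψ z)) = e₁ (b₁.incl z)) :
    IsBoundaryGluing b₁ b₂ ψ (𝓡 (m + 1)) X := by
  refine ⟨e₁, e₂, he₁, he₂, hcover, fun a a' => ⟨fun h => ?_, ?_⟩⟩
  · have hmem : e₁ a ∈ range e₁ ∩ range e₂ := ⟨⟨a, rfl⟩, ⟨a', h.symm⟩⟩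
    rw [hseam₁] at hmem
    obtain ⟨a₀, ha₀, hae⟩ := hmem
    have haa : a₀ = a := he₁.isEmbedding.injective hae
    subst haa
    have ha : a₀ ∈ range b₁.incl := by rw [b₁.range_incl]; exact ha₀
    obtain ⟨z, rfl⟩ := ha
    refine ⟨z, rfl, he₂.isEmbedding.injective ?_⟩
    rw [hψ z]
    exact h.symm
  · rintro ⟨z, rfl, rfl⟩
    exact (hψ z).symm

end Bisection

section FourDim

variable {X : Type} [TopologicalSpace X] [ChartedSpace (EuclideanSpace ℝ (Fin 4)) X] [IsManifold (𝓡 4) ∞ X]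
  {W₁ : Type} [TopologicalSpace W₁] [T2Space W₁] [CompactSpace W₁]
  [ChartedSpace (EuclideanHalfSpace 4) W₁] [IsManifold (𝓡∂ 4) ∞ W₁]
  {W₂ : Type} [TopologicalSpace W₂] [T2Space W₂] [CompactSpace W₂]
  [ChartedSpace (EuclideanHalfSpace 4) W₂] [IsManifold (𝓡∂ 4) ∞ W₂]

/-- **Morse gluing across the seam of a bisected smooth 4-manifold.**  Let the smooth 4-manifold
`X` be covered by two smoothly embedded compact pieces `e₁(W₁)`, `e₂(W₂)` meeting exactly along
`e₁(∂W₁)`, with a seam diffeomorphism `ψ : ∂W₁ ≅ ∂W₂` (`e₂ ∘ incl ∘ ψ = e₁ ∘ incl`; for the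
common-contact Stein bisections of the crux such a `ψ` is the landed `LegendrianRKnotRigidity.stub_seam`),
and let `f₁`, `f₂` be Morse functions adapted to the boundaries of the (nonempty-boundary) halves.
Then `X` carries a Morse function `F` with `#Crit_i(F) = #Crit_i(f₁) + #Crit_j(f₂)` for
`i + j = 4` — for balanced 2-handlebody halves the profile `(c₀(f₁); c₁(f₁); c₂(f₁)+c₂(f₂); c₁(f₂); c₀(f₂))`
read from `W₁`'s side, the common first step of the cross-seam cancellation levers.
[cite: MilnorHCobordism1965, §1 and proof of Thm. 3.4] -/
theorem exists_isMorse_of_bisection {e₁ : W₁ → X} {e₂ : W₂ → X}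
    (he₁ : Manifold.IsSmoothEmbedding (𝓡∂ 4) (𝓡 4) ∞ e₁)
    (he₂ : Manifold.IsSmoothEmbedding (𝓡∂ 4) (𝓡 4) ∞ e₂)
    (hcover : range e₁ ∪ range e₂ = univ)
    (hseam₁ : range e₁ ∩ range e₂ = e₁ '' (𝓡∂ 4).boundary W₁)
    (b₁ : BoundaryData (𝓡∂ 4) W₁ (𝓡 3)) (b₂ : BoundaryData (𝓡∂ 4) W₂ (𝓡 3))
    [Nonempty b₁.carrier]
    (ψ : b₁.carrier ≃ₘ⟮𝓡 3, 𝓡 3⟯ b₂.carrier) (hψ : ∀ z, e₂ (b₂.incl (ψ z)) = e₁ (b₁.incl z))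
    {f₁ : W₁ → ℝ} (hf₁ : IsMorseAdapted (𝓡∂ 4) f₁) {f₂ : W₂ → ℝ} (hf₂ : IsMorseAdapted (𝓡∂ 4) f₂) :
    ∃ F : X → ℝ, IsMorse (𝓡 4) F ∧
      ∀ i j : ℕ, i + j = 4 →
        (criticalSetOfIndex (𝓡 4) F i).ncard =
          (criticalSetOfIndex (𝓡∂ 4) f₁ i).ncard + (criticalSetOfIndex (𝓡∂ 4) f₂ j).ncard := by
  haveI : Nonempty b₂.carrier := ⟨ψ (Classical.arbitrary _)⟩
  have hglue : IsBoundaryGluing b₁ b₂ ψ (𝓡 4) X :=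
    isBoundaryGluing_of_bisection he₁ he₂ hcover hseam₁ b₁ b₂ ψ hψ
  exact exists_isMorse_of_isBoundaryGluing (n := 2) hf₁ hf₂ ψ hglue

end FourDim

end Summit.SmoothPoincare4.SmoothPoincare4.Theorems.AcyclicBisectionRigidity.SeamGluing

end
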